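import Literature.NumberTheory.EllipticCurves.CuspFormsGamma1EisensteinDivision
import Literature.NumberTheory.EllipticCurves.NewformsSpanGamma1Proofs
import Literature.NumberTheory.EllipticCurves.DeligneSerreProp27Proofs
import Literature.NumberTheory.EllipticCurves.DeligneSerreWeightOneProofs
import Literature.NumberTheory.EllipticCurves.EisensteinCongruence
import Literature.NumberTheory.Automorphic.LanglandsTunnellLSeriesProofs
import Literature.NumberTheory.NumberFields.DvrPlace
import Literature.RingTheory.DiscreteValuationRing.DeligneSerreEigenvectorLift
import HarnessLib

/-!
# Deligne–Serre 1974, 6.8–6.10 for a weight-one newform: an eigenform of weight `≥ 2`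
# congruent to `f` modulo `λ`

Deligne–Serre, *Formes modulaires de poids 1*, Ann. Sci. ÉNS (4) 7 (1974), proof of Thm. 6.7,
steps 6.8–6.11 (p. 522), carried out for a **newform `f ∈ S_1(Γ₁(N))` of weight one** and a prime
`λ` of its coefficient ring with residue field `𝔽_ℓ` (the case of op. cit. §8.2), i.e. a ring
homomorphism `ι : 𝓞_f → 𝔽_ℓ`. Everything here is PROVED, from

* 6.9 (`eisenstein_qExpansion_congr_one`, `EisensteinCongruence`): `E_k ≡ 1 (mod ℓ)` for
  `(ℓ - 1) ∣ k`, so `f E_k ∈ S_{1+k}(N, ε)` has `λ`-integral coefficients, is `≡ f (mod λ)`, and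
  is an eigenvector modulo `λ` of the `T_p`, `p ∤ N ℓ`, with eigenvalues `a_p(f)` (the weight
  enters the `q`-expansion of `T_p` only through `p^{k'-1} ≡ 1 (mod ℓ)`, Fermat);
* 6.10–6.11 (`exists_eigenvector_lift`, `DeligneSerreEigenvectorLift`, from the tree's proof of
  Lemme 6.11): the mod-`λ` eigenvector `f E_k` of the `𝒪_λ`-module of forms of type `(1+k, ε)`
  with `𝒪_λ`-integral coefficients yields a genuine eigenform `g ∈ S_{1+k}(N, ε)` of the `T_p`,
  `p ∤ N ℓ`, with eigenvalues `a'_p` in a discrete valuation ring `𝒪' ⊇ 𝒪_λ`,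
  `a'_p ≡ a_p (mod 𝔪')`;
* the identification of `𝒪'` with the valuation ring of a finite place `v` of the number field
  `K' = Frac 𝒪'` (`exists_heightOneSpectrum_valuation_le_of_dvr`, `DvrPlace`);
* the degeneracy map `S_{k'}(Γ₁(N)) → S_{k'}(Γ₁(N ℓ))` (`degeneracyMap1 N (N ℓ) 1`), which
  commutes with `T_p`, `p ∤ N ℓ`, and with the diamond operators (`NewformsSpanGamma1Proofs`), to
  view `g` at level `N ℓ`, where "`p ∤` level" excludes `p = ℓ` — so that Thm. 6.1 applies to `g`
  as printed ("fonction propre des `T_p`, `p ∤ N`") without the extra step "comme `T_ℓ` commute aux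
  `T_p`, on peut aussi supposer que `f` est vecteur propre de `T_ℓ`" of op. cit. 6.12.

The only unproved input is the named fact (2.7.2) `DeligneSerre1974_span_integralLattice1 N 1`
(Eichler–Shimura rational structure in weight one; itself reduced to weights `≥ 2` in the tree),
through the finiteness of `K_f` and the integrality of the `a_n(f)`.

* `Literature.NumberTheory.EllipticCurves.ModularForms.DeligneSerre1974.exists_eigenform_congr_of_weight_one`
  — the statement: a number field `K ⊇ K_f` with an embedding `e : K → ℂ`, a finite place `v`
  of `K` above `λ = ker ι`, a weight `k' ≥ 2` with `(ℓ - 1) ∣ (k' - 1)`, a non-zero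
  `g ∈ S_{k'}(N ℓ, ε)` which is an eigenvector of all `T_p`, `p ∤ N ℓ`, with eigenvalues
  `b_p ∈ K`, `v(b_p) ≤ 1`, `b_p ≡ a_p(f) (mod v)`.

## References

* P. Deligne, J.-P. Serre, *Formes modulaires de poids 1*, Ann. Sci. ÉNS (4) 7 (1974), 6.8–6.12.
-/

noncomputable section

open scoped MatrixGroups ModularForm NumberField TensorProduct

open CongruenceSubgroup UpperHalfPlane IsLocalRing IsDedekindDomain

namespace Literature.NumberTheory.EllipticCurves.ModularForms.DeligneSerre1974

universe u

/-! ### Rational numbers in a local ring containing `ℓ` in its maximal ideal -/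

section Local

variable {𝒪 : Type*} [CommRing 𝒪] [IsLocalRing 𝒪] [Algebra 𝒪 ℂ] {ℓ : ℕ}

omit [Algebra 𝒪 ℂ] in
/-- In a local ring `𝒪` with `ℓ ∈ 𝔪`, an integer prime to `ℓ` is a unit. [folklore] -/
theorem isUnit_intCast_of_not_dvd (hℓ : ℓ.Prime) (hℓm : (ℓ : 𝒪) ∈ maximalIdeal 𝒪) {d : ℤ}
    (hd : ¬ (ℓ : ℤ) ∣ d) : IsUnit (d : 𝒪) := by
  by_contra hu
  have hdm : (d : 𝒪) ∈ maximalIdeal 𝒪 := (IsLocalRing.mem_maximalIdeal _).mpr hu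
  have hcopNat : Nat.Coprime ℓ d.natAbs :=
    (Nat.Prime.coprime_iff_not_dvd hℓ).mpr fun h ↦ hd (Int.natCast_dvd.mpr h)
  have hcop : IsCoprime (ℓ : ℤ) d := Int.isCoprime_iff_nat_coprime.mpr (by simpa using hcopNat)
  obtain ⟨a, b, hab⟩ := hcop
  have h1 : (1 : 𝒪) ∈ maximalIdeal 𝒪 := by
    have := congrArg (fun z : ℤ ↦ (z : 𝒪)) hab
    simp only [Int.cast_add, Int.cast_mul, Int.cast_natCast, Int.cast_one] at this
    rw [← this]
    exact Ideal.add_mem _ (Ideal.mul_mem_left _ _ hℓm) (Ideal.mul_mem_left _ _ hdm)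
  exact (maximalIdeal.isMaximal 𝒪).ne_top ((Ideal.eq_top_iff_one _).mpr h1)

/-- A rational number with denominator prime to `ℓ` lies in (the image of) a local ring `𝒪 → ℂ`
with `ℓ ∈ 𝔪`; if moreover `ℓ` divides its numerator, it lies in the image of `𝔪`. [folklore] -/
theorem ratCast_mem_of_not_dvd_den (hℓ : ℓ.Prime) (hℓm : (ℓ : 𝒪) ∈ maximalIdeal 𝒪)
    (r : ℚ) (hr : ¬ ℓ ∣ r.den) :
    ((r : ℂ) ∈ (algebraMap 𝒪 ℂ).range) ∧
      ((ℓ : ℤ) ∣ r.num → (r : ℂ) ∈ algebraMap 𝒪 ℂ '' (maximalIdeal 𝒪)) := by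
  have hden : IsUnit ((r.den : ℤ) : 𝒪) :=
    isUnit_intCast_of_not_dvd hℓ hℓm (by exact_mod_cast hr)
  obtain ⟨u, hu⟩ := hden
  have hu' : algebraMap 𝒪 ℂ (u : 𝒪) = r.den := by rw [hu]; simp
  have huinv : algebraMap 𝒪 ℂ ((u⁻¹ : 𝒪ˣ) : 𝒪) = (r.den : ℂ)⁻¹ :=
    eq_inv_of_mul_eq_one_left (by rw [← hu', ← map_mul, Units.inv_mul, map_one])
  have hr' : (r : ℂ) = algebraMap 𝒪 ℂ ((r.num : 𝒪) * ((u⁻¹ : 𝒪ˣ) : 𝒪)) := by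
    rw [map_mul, huinv, map_intCast, ← div_eq_mul_inv]
    exact_mod_cast (Rat.num_div_den r).symm
  refine ⟨⟨_, hr'.symm⟩, fun hnum ↦ ?_⟩
  obtain ⟨t, ht⟩ := hnum
  refine ⟨(r.num : 𝒪) * ((u⁻¹ : 𝒪ˣ) : 𝒪), Ideal.mul_mem_right _ _ ?_, hr'.symm⟩
  rw [ht, Int.cast_mul, Int.cast_natCast]
  exact Ideal.mul_mem_right _ _ hℓm

omit [Algebra 𝒪 ℂ] in
/-- Fermat: for a prime `p ≠ ℓ` and `(ℓ - 1) ∣ k`, `p ^ k - 1 ∈ 𝔪` in a local ring with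
`ℓ ∈ 𝔪`. [folklore] -/
theorem pow_sub_one_mem_maximalIdeal (hℓ : ℓ.Prime) (hℓm : (ℓ : 𝒪) ∈ maximalIdeal 𝒪)
    {p : ℕ} (hp : p.Prime) (hpℓ : p ≠ ℓ) {k : ℕ} (hk : (ℓ - 1) ∣ k) :
    (p : 𝒪) ^ k - 1 ∈ maximalIdeal 𝒪 := by
  haveI := Fact.mk hℓ
  have h1 : ((p : ZMod ℓ)) ^ k = 1 := by
    obtain ⟨c, rfl⟩ := hk
    have hp0 : (p : ZMod ℓ) ≠ 0 := by
      rw [Ne, ZMod.natCast_eq_zero_iff]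
      exact fun h ↦ hpℓ ((Nat.prime_dvd_prime_iff_eq hℓ hp).mp h).symm
    rw [pow_mul, ZMod.pow_card_sub_one_eq_one hp0, one_pow]
  have h2 : (ℓ : ℤ) ∣ (p : ℤ) ^ k - 1 := by
    rw [← ZMod.intCast_zmod_eq_zero_iff_dvd]
    push_cast
    rw [h1, sub_self]
  obtain ⟨t, ht⟩ := h2
  have : ((p : 𝒪) ^ k - 1) = ((((p : ℤ) ^ k - 1 : ℤ)) : 𝒪) := by push_cast; ring
  rw [this, ht, Int.cast_mul, Int.cast_natCast]
  exact Ideal.mul_mem_right _ _ hℓm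

end Local

/-! ### The main construction -/

section Main

variable {N : ℕ} [NeZero N]

set_option maxHeartbeats 800000 in
/-- **Deligne–Serre 1974, 6.8–6.11 for a weight-one newform.** Let `f ∈ S_1(Γ₁(N))` be a newform
with nebentypus `ε` and coefficients `a_p`, `ℓ` a prime, `ι : 𝓞_f → 𝔽_ℓ` a ring homomorphism
(`λ = ker ι`), and grant Deligne–Serre's (2.7.2) in weight one (`K_f` is a number field and the
`a_n` are integers). Then there are a number field `K` with an embedding `e : K → ℂ` and a ring
homomorphism `i : K_f → K` over `ℂ` (`e ∘ i` is the inclusion), a finite place `v` of `K`, a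
weight `k' ≥ 2` with `(ℓ - 1) ∣ (k' - 1)`, a non-zero cusp form `g ∈ S_{k'}(N ℓ, ε)` (level
`N ℓ`, nebentypus `ε` viewed modulo `N ℓ`) and `b : ℕ → K` such that: `T_p g = e(b_p) g` for
every prime `p ∤ N ℓ`; `v` lies over `λ` (`v(i y) < 1` for `y ∈ ker ι`); `v(b_p) ≤ 1` for all
`p`; and `b_p ≡ a_p (mod v)` (`v(b_p - i a_p) < 1`) for every prime `p ∤ N ℓ`. This is the output
of op. cit. 6.8–6.11 (`f' = g` "comme en 6.8, avec `(k', ε') ≡ (k, ε)`, et vecteur propre des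
`T_p`"), at level `N ℓ` so that "`p ∤` level" is the condition `p ∤ N ℓ` of Thm. 6.7.
[cite: DeligneSerreASENS1974, 6.8–6.11] -/
theorem exists_eigenform_congr_of_weight_one
    (hL : DeligneSerre1974_span_integralLattice1 N 1) {f : CuspForm (Gamma1 N) 1}
    (hf : IsNewform1 f) (ℓ : ℕ) [Fact ℓ.Prime] (ι : coeffCharIntegers f →+* ZMod ℓ) :
    ∃ (K : Type) (_ : Field K) (_ : NumberField K) (e : K →+* ℂ) (i : coeffCharField f →+* K)
      (v : HeightOneSpectrum (𝓞 K)) (k' : ℤ) (g : CuspForm (Gamma1 (N * ℓ)) k') (b : ℕ → K),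
      (∀ y, e (i y) = y) ∧ 2 ≤ k' ∧ ((ℓ : ℤ) - 1 ∣ k' - 1) ∧ g ≠ 0 ∧
      g ∈ nebentypusSubspace (N * ℓ) k'
        (DirichletCharacter.changeLevel (dvd_mul_right N ℓ) (nebentypus f)) ∧
      (∀ (p : ℕ) (hp : p.Prime), ¬ p ∣ N * ℓ →
        (haveI : NeZero p := ⟨hp.ne_zero⟩; heckeT (Gamma1 (N * ℓ)) k' p g) = e (b p) • g) ∧
      (∀ y : coeffCharIntegers f, ι y = 0 → v.valuation K (i y) < 1) ∧
      (∀ p : ℕ, v.valuation K (b p) ≤ 1) ∧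
      (∀ p : ℕ, p.Prime → ¬ p ∣ N * ℓ →
        v.valuation K (b p - i ⟨cuspCoeff f p, cuspCoeff_mem_coeffCharField f p⟩) < 1) := by
  classical
  have hℓ : ℓ.Prime := Fact.out
  set ε : DirichletCharacter ℂ N := nebentypus f with hεdef
  -- ### (2.7.2): `K_f` is a number field, the `a_n` are integers
  haveI : FiniteDimensional ℚ (coeffField f) :=
    (IsNewform1.finiteDimensional_coeffField_of_span_integralLattice1 hL) hf
  haveI : FiniteDimensional ℚ (coeffCharField f) := finiteDimensional_coeffCharField f
  set K₀ : IntermediateField ℚ ℂ := coeffCharField f with hK₀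
  haveI : NumberField K₀ := NumberField.mk
  have hint : ∀ n, IsIntegral ℤ (cuspCoeff f n) := fun n ↦
    IsNewform1.isIntegral_cuspCoeff hL le_rfl hf n
  -- the integers `a_n ∈ 𝓞 K₀` and the character values `ε(d) ∈ 𝓞 K₀`
  let aO : ℕ → 𝓞 K₀ := fun n ↦ ⟨⟨cuspCoeff f n, cuspCoeff_mem_coeffCharField f n⟩,
    (isIntegral_coeffCharField_iff f).mpr (hint n)⟩
  have haO : ∀ n, ((aO n : K₀) : ℂ) = cuspCoeff f n := fun _ ↦ rfl
  let εO : ℕ → 𝓞 K₀ := fun d ↦ ⟨⟨ε (d : ZMod N), nebentypus_mem_coeffCharField f d⟩,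
    (isIntegral_coeffCharField_iff f).mpr (isIntegral_dirichletCharacter_apply ε _)⟩
  have hεO : ∀ d : ℕ, ((εO d : K₀) : ℂ) = ε (d : ZMod N) := fun _ ↦ rfl
  -- ### the prime `λ = ker ι` and the discrete valuation ring `𝒪 = (𝓞 K₀)_λ ⊆ K₀`
  let ι₀ : 𝓞 K₀ →+* ZMod ℓ := ι
  have hιsurj : Function.Surjective ι₀ := ZMod.ringHom_surjective ι₀
  haveI hmax : (RingHom.ker ι₀).IsMaximal := RingHom.ker_isMaximal_of_surjective ι₀ hιsurj
  have hℓker : (ℓ : 𝓞 K₀) ∈ RingHom.ker ι₀ := by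
    rw [RingHom.mem_ker, map_natCast, ZMod.natCast_self]
  have hker0 : RingHom.ker ι₀ ≠ ⊥ := fun h ↦ by
    have : (ℓ : 𝓞 K₀) = 0 := by simpa [h] using hℓker
    exact hℓ.ne_zero (by exact_mod_cast this)
  obtain ⟨v₀, hv₀⟩ : ∃ v₀ : HeightOneSpectrum (𝓞 K₀), v₀.asIdeal = RingHom.ker ι₀ :=
    ⟨⟨RingHom.ker ι₀, hmax.isPrime, hker0⟩, rfl⟩
  let 𝒪 : Type := HeightOneSpectrum.valuationSubringAtPrime K₀ v₀
  haveI : IsLocalization.AtPrime 𝒪 v₀.asIdeal :=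
    inferInstanceAs (IsLocalization v₀.asIdeal.primeCompl
      (HeightOneSpectrum.valuationSubringAtPrime K₀ v₀))
  haveI : IsLocalRing 𝒪 := IsLocalization.AtPrime.isLocalRing 𝒪 v₀.asIdeal
  haveI : IsDiscreteValuationRing 𝒪 :=
    IsLocalization.AtPrime.isDiscreteValuationRing_of_dedekind_domain (𝓞 K₀) v₀.ne_bot 𝒪
  have hmax𝒪 : ∀ y : 𝓞 K₀, algebraMap (𝓞 K₀) 𝒪 y ∈ maximalIdeal 𝒪 ↔ y ∈ RingHom.ker ι₀ :=
    fun y ↦ hv₀ ▸ IsLocalization.AtPrime.to_map_mem_maximal_iff 𝒪 v₀.asIdeal y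
  have hℓ𝒪 : (ℓ : 𝒪) ∈ maximalIdeal 𝒪 := by
    have := (hmax𝒪 ℓ).mpr hℓker
    rwa [map_natCast] at this
  -- `𝒪 → K₀ → ℂ`
  letI alg𝒪 : Algebra 𝒪 ℂ := ((algebraMap K₀ ℂ).comp (algebraMap 𝒪 K₀)).toAlgebra
  have halg : ∀ s : 𝒪, algebraMap 𝒪 ℂ s = ((algebraMap 𝒪 K₀ s : K₀) : ℂ) := fun _ ↦ rfl
  have hinj : Function.Injective (algebraMap 𝒪 ℂ) :=
    (algebraMap K₀ ℂ).injective.comp (IsFractionRing.injective 𝒪 K₀)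
  have halgO : ∀ y : 𝓞 K₀, algebraMap 𝒪 ℂ (algebraMap (𝓞 K₀) 𝒪 y) = ((y : K₀) : ℂ) := by
    intro y
    rw [halg, ← IsScalarTower.algebraMap_apply (𝓞 K₀) 𝒪 K₀ y]
  -- ### 6.9: the Eisenstein series and the form `fE = f · E_k` of weight `k' = 1 + k`
  obtain ⟨k, hk3, hkev, hkℓ⟩ := exists_eisenstein_weight hℓ
  set E := ModularForm.E hk3 with hEdef
  obtain ⟨hE0, hEm⟩ := eisenstein_qExpansion_congr_one (ℓ := ℓ) hk3 hkev hkℓ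
  let V : Type := CuspForm (Gamma1 N) (1 + (k : ℤ))
  let x : V := f.mulModularForm (ofLevelOne (Gamma1 N) E)
  have hxq : qExpansion 1 ⇑x = qExpansion 1 ⇑f * qExpansion 1 ⇑E :=
    qExpansion_mulModularForm_ofLevelOne E f
  -- ### the setting of `exists_eigenvector_lift`
  letI mod𝒪 : Module 𝒪 V := Module.compHom V (algebraMap 𝒪 ℂ)
  haveI : IsScalarTower 𝒪 ℂ V := ⟨fun r z w ↦ mul_smul (algebraMap 𝒪 ℂ r) z w⟩
  let W : Submodule ℂ V := nebentypusSubspace N (1 + (k : ℤ)) ε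
  let c : ℕ → (V →ₗ[ℂ] ℂ) := fun m ↦ cuspCoeffₗ (HeckeTGamma1.one_mem_strictPeriods_Gamma1 N) m
  have hc_apply : ∀ (m : ℕ) (w : V), c m w = cuspCoeff w m := fun _ _ ↦ rfl
  -- Sturm bound
  let B : ℕ := (((1 + (k : ℤ)) * Nat.card (𝒮ℒ ⧸ (Gamma1 N : Subgroup (GL (Fin 2) ℝ)).subgroupOf 𝒮ℒ)).toNat
    / 12 : ℕ) + 2
  have hc : ∀ w ∈ W, (∀ m < B, c m w = 0) → w = 0 := fun w _ hw ↦
    cuspForm_eq_zero_of_qExpansion_coeff_eq_zero (HeckeTGamma1.one_mem_strictPeriods_Gamma1 N)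
      w (m := B) (fun i hi ↦ hw i hi) (by simp only [B]; omega)
  -- the operators `T_p`, `p ∤ N ℓ`
  let P : Type := {p : ℕ // p.Prime ∧ ¬ p ∣ N * ℓ}
  let Tp : P → (V →ₗ[ℂ] V) := fun p ↦
    haveI : NeZero p.1 := ⟨p.2.1.ne_zero⟩; heckeT (Gamma1 N) (1 + (k : ℤ)) p.1
  let 𝒯 : Set (V →ₗ[ℂ] V) := Set.range Tp
  have hcomm : ∀ S ∈ 𝒯, ∀ T ∈ 𝒯, Commute S T := by
    rintro _ ⟨p, rfl⟩ _ ⟨q, rfl⟩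
    haveI : NeZero p.1 := ⟨p.2.1.ne_zero⟩
    haveI : NeZero q.1 := ⟨q.2.1.ne_zero⟩
    exact heckeT_comm_holds N (1 + (k : ℤ)) p.1 q.1
  have hWmem : ∀ w : V, w ∈ W ↔ ∀ d : (ZMod N)ˣ,
      diamondOp N (1 + (k : ℤ)) (d : ZMod N) w = ε d • w :=
    fun w ↦ mem_nebentypusSubspace_iff_diamondOp
  have hW : ∀ T ∈ 𝒯, ∀ w ∈ W, T w ∈ W := by
    rintro _ ⟨p, rfl⟩ w hw
    haveI : NeZero p.1 := ⟨p.2.1.ne_zero⟩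
    rw [hWmem] at hw ⊢
    intro d
    change diamondOp N _ d (heckeT (Gamma1 N) _ p.1 w) = ε d • heckeT (Gamma1 N) _ p.1 w
    rw [← Module.End.mul_apply, ← heckeT_diamondOp_comm_holds N (1 + (k : ℤ)) p.1 (d : ZMod N),
      Module.End.mul_apply, hw d, map_smul]
  -- ### ranges and the image of `𝔪`
  set I : Set ℂ := algebraMap 𝒪 ℂ '' (maximalIdeal 𝒪) with hIdef
  have hR_mem : ∀ t : ℂ, t ∈ (algebraMap 𝒪 ℂ).range ↔ ∃ s : 𝒪, algebraMap 𝒪 ℂ s = t :=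
    fun t ↦ RingHom.mem_range
  have hI_sub : ∀ t ∈ I, t ∈ (algebraMap 𝒪 ℂ).range := by
    rintro _ ⟨s, -, rfl⟩; exact ⟨s, rfl⟩
  have hI_add : ∀ t₁ ∈ I, ∀ t₂ ∈ I, t₁ + t₂ ∈ I := by
    rintro _ ⟨s₁, h₁, rfl⟩ _ ⟨s₂, h₂, rfl⟩
    exact ⟨s₁ + s₂, Ideal.add_mem _ h₁ h₂, map_add _ _ _⟩
  have hI_zero : (0 : ℂ) ∈ I := ⟨0, Ideal.zero_mem _, map_zero _⟩
  have hI_mul : ∀ r ∈ (algebraMap 𝒪 ℂ).range, ∀ t ∈ I, r * t ∈ I := by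
    rintro _ ⟨s₁, rfl⟩ _ ⟨s₂, h₂, rfl⟩
    exact ⟨s₁ * s₂, Ideal.mul_mem_left _ _ h₂, map_mul _ _ _⟩
  have hI_neg : ∀ t ∈ I, -t ∈ I := by
    rintro _ ⟨s, h, rfl⟩; exact ⟨-s, Submodule.neg_mem _ h, map_neg _ _⟩
  have hI_sum : ∀ {α : Type} (s : Finset α) (u : α → ℂ), (∀ a ∈ s, u a ∈ I) →
      ∑ a ∈ s, u a ∈ I := by
    intro α s u hu
    induction s using Finset.induction_on with
    | empty => simpa using hI_zero
    | insert a s ha ih =>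
      rw [Finset.sum_insert ha]
      exact hI_add _ (hu a (Finset.mem_insert_self a s)) _
        (ih fun b hb ↦ hu b (Finset.mem_insert_of_mem hb))
  have hR_sum : ∀ {α : Type} (s : Finset α) (u : α → ℂ), (∀ a ∈ s, u a ∈ (algebraMap 𝒪 ℂ).range) →
      ∑ a ∈ s, u a ∈ (algebraMap 𝒪 ℂ).range := fun s u hu ↦ Subring.sum_mem _ hu
  -- coefficients of `f`, `ε(d)` lie in the range
  have haR : ∀ n, cuspCoeff f n ∈ (algebraMap 𝒪 ℂ).range := fun n ↦
    ⟨algebraMap (𝓞 K₀) 𝒪 (aO n), halgO (aO n)⟩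
  have hεR : ∀ d : ℕ, (ε (d : ZMod N) : ℂ) ∈ (algebraMap 𝒪 ℂ).range := fun d ↦
    ⟨algebraMap (𝓞 K₀) 𝒪 (εO d), halgO (εO d)⟩
  -- coefficients of `E`: `e_0 = 1`, `e_j ∈ I` for `j ≠ 0`
  have hEI : ∀ j, j ≠ 0 → (qExpansion 1 ⇑E).coeff j ∈ I := by
    intro j hj
    obtain ⟨r, hr, hrj⟩ := hEm j hj
    rw [hrj]
    have hnum := (padicValuation_lt_one_iff_dvd_num r).mp hr
    have hden : ¬ ℓ ∣ r.den := by
      intro h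
      have h1 : ℓ ∣ r.num.natAbs := Int.natCast_dvd.mp hnum
      have h2 : ℓ ∣ r.num.natAbs.gcd r.den := Nat.dvd_gcd h1 h
      rw [r.reduced.gcd_eq_one] at h2
      exact hℓ.ne_one (Nat.dvd_one.mp h2)
    exact (ratCast_mem_of_not_dvd_den hℓ hℓ𝒪 r hden).2 hnum
  -- ### coefficients of `x = f E`: `a_m(x) - a_m(f) ∈ I`, hence `a_m(x)` integral, `a_1(x) = 1`
  have hxcoeff : ∀ m, cuspCoeff x m - cuspCoeff f m ∈ I := by
    intro m
    have hmul : cuspCoeff x m = ∑ ij ∈ Finset.HasAntidiagonal.antidiagonal m,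
        cuspCoeff f ij.1 * (qExpansion 1 ⇑E).coeff ij.2 := by
      change (qExpansion 1 ⇑x).coeff m = _
      rw [hxq, PowerSeries.coeff_mul]
      rfl
    have hmem : (m, 0) ∈ Finset.HasAntidiagonal.antidiagonal m := by simp
    rw [hmul, ← Finset.add_sum_erase _ _ hmem, hE0, mul_one, add_sub_cancel_left]
    refine hI_sum _ _ fun ij hij ↦ ?_
    obtain ⟨hne, hij'⟩ := Finset.mem_erase.mp hij
    have hj : ij.2 ≠ 0 := by
      intro h
      apply hne
      have := Finset.HasAntidiagonal.mem_antidiagonal.mp hij'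
      rw [h, add_zero] at this
      exact Prod.ext this h
    exact hI_mul _ (haR _) _ (hEI _ hj)
  have hxR : ∀ m, cuspCoeff x m ∈ (algebraMap 𝒪 ℂ).range := fun m ↦ by
    have := Subring.add_mem _ (hI_sub _ (hxcoeff m)) (haR m)
    rwa [sub_add_cancel] at this
  have hx1 : cuspCoeff x 1 = 1 := by
    have hmul : cuspCoeff x 1 = ∑ ij ∈ Finset.HasAntidiagonal.antidiagonal 1,
        cuspCoeff f ij.1 * (qExpansion 1 ⇑E).coeff ij.2 := by
      change (qExpansion 1 ⇑x).coeff 1 = _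
      rw [hxq, PowerSeries.coeff_mul]
      rfl
    rw [hmul, Finset.Nat.antidiagonal_succ, Finset.sum_cons, Finset.Nat.antidiagonal_zero]
    simp only [Finset.map_singleton, Finset.sum_singleton, Function.Embedding.coe_prodMap,
      Function.Embedding.coeFn_mk, Prod.map_apply, Nat.succ_eq_add_one, zero_add,
      Function.Embedding.refl_apply]
    rw [show cuspCoeff f 0 = 0 from CuspFormClass.qExpansion_coeff_zero f one_pos
      (HeckeTGamma1.one_mem_strictPeriods_Gamma1 N), zero_mul, zero_add,
      show cuspCoeff f 1 = 1 from hf.2.2.2, hE0, one_mul]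
  -- `x ∈ W`
  have hfW1 : ∀ d : (ZMod N)ˣ, diamondOp N 1 (d : ZMod N) f = ε d • f :=
    mem_nebentypusSubspace_iff_diamondOp.mp (IsNewform1.mem_nebentypusSubspace_nebentypus_holds hf)
  have hxW : x ∈ W := by
    rw [hWmem]
    intro d
    change diamondOp N (1 + (k : ℤ)) d (f.mulModularForm (ofLevelOne (Gamma1 N) E)) = _
    rw [diamondOp_mulModularForm_ofLevelOne E (d : ZMod N) f, hfW1 d, smul_mulModularForm]
  -- ### the mod-`𝔪` eigenvalues `a_p` and the congruence (6.9)
  let a : (V →ₗ[ℂ] V) → 𝒪 := fun T ↦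
    if h : ∃ p : P, Tp p = T then algebraMap (𝓞 K₀) 𝒪 (aO h.choose.1) else 0
  -- the key computation, for every admissible `p`
  have hkey : ∀ (p : P) (m : ℕ),
      c m (Tp p x) - algebraMap 𝒪 ℂ (algebraMap (𝓞 K₀) 𝒪 (aO p.1)) * c m x ∈ I := by
    intro p m
    obtain ⟨hp, hpNℓ⟩ := p.2
    haveI : NeZero p.1 := ⟨hp.ne_zero⟩
    have hpN : ¬ p.1 ∣ N := fun h ↦ hpNℓ (h.mul_right ℓ)
    have hpℓ : p.1 ≠ ℓ := fun h ↦ hpNℓ (by rw [h]; exact dvd_mul_left ℓ N)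
    rw [halgO, haO, hc_apply, hc_apply]
    change cuspCoeff (heckeT (Gamma1 N) (1 + (k : ℤ)) p.1 x) m - cuspCoeff f p.1 * cuspCoeff x m ∈ I
    -- `T_p` on `x` (weight `1 + k`) and on `f` (weight `1`)
    have hu : IsUnit ((p.1 : ℕ) : ZMod N) := (ZMod.isUnit_prime_iff_not_dvd hp).mpr hpN
    obtain ⟨d, hd⟩ := hu
    have hdiag_x : diamondOp N (1 + (k : ℤ)) (p.1 : ZMod N) x = ε (p.1 : ZMod N) • x := by
      rw [← hd]; exact (hWmem x).mp hxW d
    have hdiag_f : diamondOp N 1 (p.1 : ZMod N) f = ε (p.1 : ZMod N) • f := by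
      rw [← hd]; exact hfW1 d
    have hTx := cuspCoeff_heckeT_gamma1 x p.1 hp m
    rw [if_neg hpN, hdiag_x] at hTx
    have hTf := cuspCoeff_heckeT_gamma1 f p.1 hp m
    rw [if_neg hpN, hdiag_f, sub_self, zpow_zero, one_mul] at hTf
    -- `T_p f = a_p f`
    have heig : heckeT (Gamma1 N) 1 p.1 f = cuspCoeff f p.1 • f := by
      have := heckeT_eq_heckeEigenvalue_smul f p.1 (hf.2.1 p.1 hp)
      rwa [IsNewform1.heckeEigenvalue_eq_coeff_holds hf hp] at this
    have hTf' : cuspCoeff (heckeT (Gamma1 N) 1 p.1 f) m = cuspCoeff f p.1 * cuspCoeff f m := by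
      rw [heig]
      exact (cuspCoeffₗ (HeckeTGamma1.one_mem_strictPeriods_Gamma1 N) m).map_smul _ _
    -- coefficients of the twisted forms
    have hsmul_x : ∀ n, cuspCoeff (ε (p.1 : ZMod N) • x) n = ε (p.1 : ZMod N) * cuspCoeff x n :=
      fun n ↦ (cuspCoeffₗ (HeckeTGamma1.one_mem_strictPeriods_Gamma1 N) n).map_smul _ _
    have hsmul_f : ∀ n, cuspCoeff (ε (p.1 : ZMod N) • f) n = ε (p.1 : ZMod N) * cuspCoeff f n :=
      fun n ↦ (cuspCoeffₗ (HeckeTGamma1.one_mem_strictPeriods_Gamma1 N) n).map_smul _ _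
    have hapf : cuspCoeff f p.1 * cuspCoeff f m = cuspCoeff f (p.1 * m) +
        (if p.1 ∣ m then ε (p.1 : ZMod N) * cuspCoeff f (m / p.1) else 0) := by
      rw [← hTf', hTf]
      by_cases hpm : p.1 ∣ m
      · rw [if_pos hpm, if_pos hpm, hsmul_f]
      · rw [if_neg hpm, if_neg hpm]
    rw [hTx, show (1 : ℤ) + (k : ℕ) - 1 = ((k : ℕ) : ℤ) by omega, zpow_natCast]
    have hδ : ∀ n, cuspCoeff x n - cuspCoeff f n ∈ I := hxcoeff
    have hAR : cuspCoeff f p.1 ∈ (algebraMap 𝒪 ℂ).range := haR p.1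
    by_cases hpm : p.1 ∣ m
    · rw [if_pos hpm, hsmul_x] 
      rw [if_pos hpm] at hapf
      have hp𝒪 : ((p.1 : ℂ)) ^ k - 1 ∈ I := by
        refine ⟨(p.1 : 𝒪) ^ k - 1, pow_sub_one_mem_maximalIdeal hℓ hℓ𝒪 hp hpℓ hkℓ, ?_⟩
        rw [map_sub, map_pow, map_natCast, map_one]
      have e1 : cuspCoeff x (p.1 * m) + (p.1 : ℂ) ^ k * (ε (p.1 : ZMod N) * cuspCoeff x (m / p.1)) -
          cuspCoeff f p.1 * cuspCoeff x m =
          (cuspCoeff x (p.1 * m) - cuspCoeff f (p.1 * m)) +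
            ε (p.1 : ZMod N) * (cuspCoeff x (m / p.1) * ((p.1 : ℂ) ^ k - 1) +
              (cuspCoeff x (m / p.1) - cuspCoeff f (m / p.1))) +
            -(cuspCoeff f p.1 * (cuspCoeff x m - cuspCoeff f m)) := by
        linear_combination -hapf
      rw [e1]
      refine hI_add _ (hI_add _ (hδ _) _ (hI_mul _ (hεR p.1) _ (hI_add _ ?_ _ (hδ _)))) _
        (hI_neg _ (hI_mul _ hAR _ (hδ m)))
      exact hI_mul _ (hxR _) _ hp𝒪
    · rw [if_neg hpm, mul_zero, add_zero]
      rw [if_neg hpm, add_zero] at hapf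
      have e1 : cuspCoeff x (p.1 * m) - cuspCoeff f p.1 * cuspCoeff x m =
          (cuspCoeff x (p.1 * m) - cuspCoeff f (p.1 * m)) +
            -(cuspCoeff f p.1 * (cuspCoeff x m - cuspCoeff f m)) := by
        linear_combination -hapf
      rw [e1]
      exact hI_add _ (hδ _) _ (hI_neg _ (hI_mul _ hAR _ (hδ m)))
  have hcongr : ∀ T ∈ 𝒯, ∀ m,
      c m (T x) - algebraMap 𝒪 ℂ (a T) * c m x ∈ algebraMap 𝒪 ℂ '' (maximalIdeal 𝒪) := by
    intro T hT m
    have h : ∃ p : P, Tp p = T := hT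
    have hchoose := hkey h.choose m
    rw [h.choose_spec] at hchoose
    simp only [a, dif_pos h]
    exact hchoose
  -- integrality is preserved by the `T_p`
  have hintT : ∀ T ∈ 𝒯, ∀ w ∈ W, (∀ m, c m w ∈ (algebraMap 𝒪 ℂ).range) →
      ∀ m, c m (T w) ∈ (algebraMap 𝒪 ℂ).range := by
    rintro _ ⟨p, rfl⟩ w hw hwint m
    obtain ⟨hp, hpNℓ⟩ := p.2
    haveI : NeZero p.1 := ⟨hp.ne_zero⟩
    have hpN : ¬ p.1 ∣ N := fun h ↦ hpNℓ (h.mul_right ℓ)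
    obtain ⟨d, hd⟩ := (ZMod.isUnit_prime_iff_not_dvd hp).mpr hpN
    have hdiag : diamondOp N (1 + (k : ℤ)) (p.1 : ZMod N) w = ε (p.1 : ZMod N) • w := by
      rw [← hd]; exact (hWmem w).mp hw d
    simp only [hc_apply] at hwint ⊢
    change cuspCoeff (heckeT (Gamma1 N) (1 + (k : ℤ)) p.1 w) m ∈ _
    rw [cuspCoeff_heckeT_gamma1 w p.1 hp m, if_neg hpN, hdiag,
      show (1 : ℤ) + (k : ℕ) - 1 = ((k : ℕ) : ℤ) by omega, zpow_natCast]
    refine Subring.add_mem _ (hwint _) (Subring.mul_mem _ ?_ ?_)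
    · exact ⟨(p.1 : 𝒪) ^ k, by rw [map_pow, map_natCast]⟩
    · by_cases hpm : p.1 ∣ m
      · have hsm : cuspCoeff (ε (p.1 : ZMod N) • w) (m / p.1) = ε (p.1 : ZMod N) * cuspCoeff w (m / p.1) :=
          (cuspCoeffₗ (HeckeTGamma1.one_mem_strictPeriods_Gamma1 N) (m / p.1)).map_smul _ _
        rw [if_pos hpm, hsm]
        exact Subring.mul_mem _ (hεR p.1) (hwint _)
      · rw [if_neg hpm]; exact Subring.zero_mem _
  have hx : ∀ m, c m x ∈ (algebraMap 𝒪 ℂ).range := fun m ↦ by rw [hc_apply]; exact hxR m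
  -- ### 6.10–6.11: the lift
  obtain ⟨K', _, _, _, _, _, 𝒪', _, _, _, _, _, _, _, e, hcomap, he, a', g₁, hg₁0, hg₁W, heig,
    hcong⟩ :=
    Literature.RingTheory.DiscreteValuationRing.DeligneSerre1974.exists_eigenvector_lift hinj W c B
      hc 𝒯 hcomm hW hintT x hxW hx 1 (by rw [hc_apply]; exact hx1) a hcongr
  -- ### `K'` is a number field; the embeddings
  set F := FractionRing 𝒪 with hFdef
  let φ : K₀ ≃ₐ[𝒪] F := (FractionRing.algEquiv 𝒪 K₀).symm
  haveI : CharZero K' :=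
    charZero_of_injective_algebraMap (algebraMap F K').injective
  have hφℚ : ∀ (q : ℚ) (y : K₀), φ (q • y) = q • φ y := fun q y ↦ by
    rw [Rat.smul_def, Rat.smul_def, map_mul, map_ratCast]
  let φℚ : K₀ ≃ₗ[ℚ] F :=
    { φ.toRingEquiv.toAddEquiv with map_smul' := hφℚ }
  haveI : Module.Finite ℚ F := Module.Finite.equiv φℚ
  haveI : Module.Finite ℚ K' := Module.Finite.trans F K'
  haveI : NumberField K' := NumberField.mk
  let i : K₀ →+* K' := (algebraMap F K').comp φ.toRingEquiv.toRingHom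
  have hi : ∀ y : K₀, i y = algebraMap F K' (φ y) := fun _ ↦ rfl
  -- `e ∘ i` is the inclusion `K₀ ⊆ ℂ`
  have hei : ∀ y : K₀, e (i y) = y := by
    have hext : e.comp (algebraMap F K') = (algebraMap K₀ ℂ).comp φ.symm.toRingEquiv.toRingHom := by
      refine IsLocalization.ringHom_ext (nonZeroDivisors 𝒪) (RingHom.ext fun y ↦ ?_)
      simp only [RingHom.comp_apply]
      rw [← IsScalarTower.algebraMap_apply 𝒪 F K', he y]
      change _ = algebraMap K₀ ℂ (φ.symm (algebraMap 𝒪 F y))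
      rw [AlgEquiv.commutes]
      rfl
    intro y
    have := congrArg (fun h : F →+* ℂ ↦ h (φ y)) hext
    simp only [RingHom.comp_apply] at this
    rw [hi, this]
    change algebraMap K₀ ℂ (φ.symm (φ y)) = y
    rw [AlgEquiv.symm_apply_apply]
    rfl
  -- ### the place `v` of `K'` attached to `𝒪'`
  have hℓ𝒪' : ((ℓ : ℕ) : 𝒪') ∈ maximalIdeal 𝒪' := by
    rw [← map_natCast (algebraMap 𝒪 𝒪') ℓ, ← Ideal.mem_comap, hcomap]
    exact hℓ𝒪
  obtain ⟨v, hv1, hv2⟩ :=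
    Literature.NumberTheory.NumberFields.exists_heightOneSpectrum_valuation_le_of_dvr K' 𝒪' hℓ hℓ𝒪'
  -- elements of `ker ι` have valuation `< 1`
  have hval𝒪 : ∀ s : 𝒪, i (algebraMap 𝒪 K₀ s) = algebraMap 𝒪' K' (algebraMap 𝒪 𝒪' s) := by
    intro s
    rw [hi, ← IsScalarTower.algebraMap_apply 𝒪 𝒪' K', IsScalarTower.algebraMap_apply 𝒪 F K']
    congr 1
    exact φ.commutes s
  have hker : ∀ y : coeffCharIntegers f, ι y = 0 → v.valuation K' (i y) < 1 := by
    intro y hy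
    have hy' : (y : 𝓞 K₀) ∈ RingHom.ker ι₀ := hy
    have h1 : algebraMap (𝓞 K₀) 𝒪 y ∈ maximalIdeal 𝒪 := (hmax𝒪 y).mpr hy'
    have h2 : algebraMap 𝒪 𝒪' (algebraMap (𝓞 K₀) 𝒪 y) ∈ maximalIdeal 𝒪' := by
      rw [← Ideal.mem_comap, hcomap]; exact h1
    have h3 := hv2 _ h2
    rw [← hval𝒪, ← IsScalarTower.algebraMap_apply (𝓞 K₀) 𝒪 K₀] at h3
    exact h3
  -- ### level `N ℓ`: the form `g` and its eigenvalues `b`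
  haveI : NeZero (N * ℓ) := ⟨mul_ne_zero (NeZero.ne N) hℓ.ne_zero⟩
  have hN1 : N * 1 ∣ N * ℓ := by rw [mul_one]; exact dvd_mul_right N ℓ
  let g : CuspForm (Gamma1 (N * ℓ)) (1 + (k : ℤ)) := degeneracyMap1 N (N * ℓ) 1 (1 + (k : ℤ)) g₁
  have hgcoeff : ∀ n, cuspCoeff g n = cuspCoeff g₁ n := fun n ↦ by
    change cuspCoeff (degeneracyMap1 N (N * ℓ) 1 (1 + (k : ℤ)) g₁) n = _
    rw [cuspCoeff_degeneracyMap1 hN1 g₁ n]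
    simp
  have hg0 : g ≠ 0 := by
    intro hg
    apply hg₁0
    refine eq_of_forall_cuspCoeff_eq_gamma1 fun n ↦ ?_
    rw [← hgcoeff, hg]
    change (qExpansion 1 ⇑(0 : CuspForm (Gamma1 (N * ℓ)) (1 + (k : ℤ)))).coeff n =
      (qExpansion 1 ⇑(0 : CuspForm (Gamma1 N) (1 + (k : ℤ)))).coeff n
    simp [qExpansion_zero]
  let b : ℕ → K' := fun p ↦
    if hp : p.Prime ∧ ¬ p ∣ N * ℓ then algebraMap 𝒪' K' (a' (Tp ⟨p, hp⟩)) else 0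
  -- nebentypus at level `N ℓ`
  have hgW : g ∈ nebentypusSubspace (N * ℓ) (1 + (k : ℤ))
      (DirichletCharacter.changeLevel (dvd_mul_right N ℓ) ε) := by
    rw [mem_nebentypusSubspace_iff_diamondOp]
    intro d
    change diamondOp (N * ℓ) _ (d : ZMod (N * ℓ)) (degeneracyMap1 N (N * ℓ) 1 _ g₁) = _
    rw [diamondOp_degeneracyMap1 (N * ℓ) (1 + (k : ℤ)) hN1 d.isUnit g₁,
      DirichletCharacter.changeLevel_eq_cast_of_dvd ε (dvd_mul_right N ℓ) d]
    have hu : IsUnit (ZMod.castHom (dvd_mul_right N ℓ) (ZMod N) (d : ZMod (N * ℓ))) :=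
      d.isUnit.map _
    obtain ⟨d', hd'⟩ := hu
    have h1 : diamondOp N (1 + (k : ℤ)) (ZMod.castHom (dvd_mul_right N ℓ) (ZMod N) (d : ZMod (N * ℓ))) g₁ =
        ε (ZMod.castHom (dvd_mul_right N ℓ) (ZMod N) (d : ZMod (N * ℓ))) • g₁ := by
      rw [← hd']; exact (hWmem g₁).mp hg₁W d'
    rw [show ZMod.castHom ((dvd_mul_right N 1).trans hN1) (ZMod N) (d : ZMod (N * ℓ)) =
      ZMod.castHom (dvd_mul_right N ℓ) (ZMod N) (d : ZMod (N * ℓ)) from rfl, h1, map_smul,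
      ZMod.castHom_apply]
  -- Hecke eigenvalues at level `N ℓ`
  have hgT : ∀ (p : ℕ) (hp : p.Prime), ¬ p ∣ N * ℓ →
      (haveI : NeZero p := ⟨hp.ne_zero⟩; heckeT (Gamma1 (N * ℓ)) (1 + (k : ℤ)) p g) = e (b p) • g := by
    intro p hp hpNℓ
    haveI : NeZero p := ⟨hp.ne_zero⟩
    have hT : Tp ⟨p, hp, hpNℓ⟩ ∈ 𝒯 := ⟨_, rfl⟩
    have h1 := heig _ hT
    change heckeT (Gamma1 N) (1 + (k : ℤ)) p g₁ = _ at h1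
    change heckeT (Gamma1 (N * ℓ)) (1 + (k : ℤ)) p (degeneracyMap1 N (N * ℓ) 1 _ g₁) = _
    have hpd : ¬ p ∣ 1 := fun h ↦ hp.one_lt.ne' (Nat.dvd_one.mp h)
    have hMN : p ∣ N ↔ p ∣ N * ℓ := ⟨fun h ↦ h.mul_right ℓ, fun h ↦ absurd h hpNℓ⟩
    rw [heckeT_degeneracyMap1_of_not_dvd (1 + (k : ℤ)) hN1 hp hpd hMN g₁, h1, map_smul]
    simp only [b, dif_pos (And.intro hp hpNℓ)]
    rfl
  -- ### conclusion
  refine ⟨K', inferInstance, inferInstance, e, i, v, 1 + (k : ℤ), g, b, hei, by omega, ?_, hg0,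
    hgW, hgT, hker, fun p ↦ ?_, fun p hp hpNℓ ↦ ?_⟩
  · rw [show (1 : ℤ) + (k : ℕ) - 1 = ((k : ℕ) : ℤ) by omega]
    have : ((ℓ - 1 : ℕ) : ℤ) ∣ ((k : ℕ) : ℤ) := Int.natCast_dvd_natCast.mpr hkℓ
    rwa [Nat.cast_sub hℓ.one_le, Nat.cast_one] at this
  · by_cases hp : p.Prime ∧ ¬ p ∣ N * ℓ
    · simp only [b, dif_pos hp]; exact hv1 _
    · simp only [b, dif_neg hp, map_zero]; exact zero_le
  · have hT : Tp ⟨p, hp, hpNℓ⟩ ∈ 𝒯 := ⟨_, rfl⟩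
    have h : ∃ q : P, Tp q = Tp ⟨p, hp, hpNℓ⟩ := hT
    have haT : a (Tp ⟨p, hp, hpNℓ⟩) = algebraMap (𝓞 K₀) 𝒪 (aO h.choose.1) := by
      simp only [a, dif_pos h]
    -- `a_p ≡ a_{p₀} (mod 𝔪)` for the chosen index `p₀`: compare the congruences at `m = 1`
    have hc1 : c 1 x = 1 := by rw [hc_apply]; exact hx1
    have h1 := hkey ⟨p, hp, hpNℓ⟩ 1
    have h2 := hkey h.choose 1
    rw [h.choose_spec] at h2
    rw [hc1, mul_one] at h1 h2
    have hdiff : algebraMap 𝒪 ℂ (algebraMap (𝓞 K₀) 𝒪 (aO h.choose.1) -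
        algebraMap (𝓞 K₀) 𝒪 (aO p)) ∈ I := by
      have := hI_add _ h1 _ (hI_neg _ h2)
      rw [map_sub]
      convert this using 1
      ring
    obtain ⟨s, hs, hs'⟩ := hdiff
    have hs𝒪 : algebraMap (𝓞 K₀) 𝒪 (aO h.choose.1) - algebraMap (𝓞 K₀) 𝒪 (aO p) ∈
        maximalIdeal 𝒪 := by
      rw [← hinj hs']; exact hs
    have hm' : a' (Tp ⟨p, hp, hpNℓ⟩) - algebraMap 𝒪 𝒪' (algebraMap (𝓞 K₀) 𝒪 (aO p)) ∈
        maximalIdeal 𝒪' := by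
      have h3 := hcong _ hT
      rw [haT] at h3
      have h4 : algebraMap 𝒪 𝒪' (algebraMap (𝓞 K₀) 𝒪 (aO h.choose.1) -
          algebraMap (𝓞 K₀) 𝒪 (aO p)) ∈ maximalIdeal 𝒪' := by
        rw [← Ideal.mem_comap, hcomap]; exact hs𝒪
      have := Ideal.add_mem _ h3 h4
      rw [map_sub] at this
      convert this using 1
      ring
    have h5 := hv2 _ hm'
    have hia : i ⟨cuspCoeff f p, cuspCoeff_mem_coeffCharField f p⟩ =
        algebraMap 𝒪' K' (algebraMap 𝒪 𝒪' (algebraMap (𝓞 K₀) 𝒪 (aO p))) := by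
      rw [← hval𝒪, ← IsScalarTower.algebraMap_apply (𝓞 K₀) 𝒪 K₀]
      rfl
    have hfinal : b p - i ⟨cuspCoeff f p, cuspCoeff_mem_coeffCharField f p⟩ =
        algebraMap 𝒪' K' (a' (Tp ⟨p, hp, hpNℓ⟩) -
          algebraMap 𝒪 𝒪' (algebraMap (𝓞 K₀) 𝒪 (aO p))) := by
      rw [map_sub, ← hia]
      simp only [b, dif_pos (And.intro hp hpNℓ)]
    rw [hfinal]
    exact h5

end Main

end Literature.NumberTheory.EllipticCurves.ModularForms.DeligneSerre1974
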